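import Literature.Computability.AlgebraicComplexity.GroupAlgebraRankBounds
import Literature.Computability.AlgebraicComplexity.TPPFiveByFiveIndexTwo
import Literature.Computability.AlgebraicComplexity.TPPAlt5FiveFiveFive
import Literature.GroupTheory.CommutingProbability.FiveEighthsBound
import Literature.RepresentationTheory.FiniteGroups.AlternatingFiveCharacterDegrees
import HarnessLib

/-!
# C1/C2 candidates for `⟨5,5,5⟩`: Pospelov's lower bound `R̲(G)`, `R(G) ≥ (11/8)|G|`, and the order windows `45 ≤ |G| ≤ 72` / `≤ 90` (Hart–Hedtke–Müller-Hannemann–Murthy 2013, Def. 3.2, Props. 3.8, 3.11)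

Topic `Literature/Computability/AlgebraicComplexity` (family `MatrixMultiplication`). Source:
S. Hart, I. Hedtke, M. Müller-Hannemann, S. Murthy, *A fast search algorithm for ⟨m,m,m⟩ triple
product property triples and an application for 5×5 matrix multiplication*, arXiv:1305.0448
[HartEtAl2013], §3, read first-hand from the held e-print text (`paper:arxiv-1305.0448`, tex chunks
p0007–p0008). Sibling of `GroupAlgebraRankBounds.lean` (Thm. 3.1: `R(G) ≥ 2|G| − T(G)`, the cases
`b(G) ≤ 2`), `FiveEighthsBound.lean` (Lemma 3.3) and `TPPFiveByFiveIndexTwo.lean` (Thm. 3.7,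
Neumann's `|G| ≥ 45`).

## The printed statements (chunk p0007 L13–36, p0008 L65–80, L116–125)

"For a finite group `G`, let `T(G)` be the number of irreducible complex characters of `G` and
`b(G)` the largest degree of an irreducible character of `G`. … **Theorem 3.1.** Let `G` be a group.
If `b(G) = 1`, then `R(G) = |G|`. If `b(G) = 2`, then `R(G) = 2|G| − T(G)`. If `b(G) ≥ 3`, then
`R(G) ≥ 2|G| + b(G) − T(G) − 1`. We write … `R̲(G)` for the best known lower bound (the theorem
above) for `R(G)`. **Definition 3.2** (C1 and C2 candidates). A group `G` that realizes `⟨5,5,5⟩` and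
satisfies `R̲(G) < 100` will be called C1 candidate. A group `G` that realizes `⟨5,5,5⟩` and
satisfies `R̲(G) < 125` will be called C2 candidate."  **Proposition 3.8.** "If `G` is a C1
candidate, then `G` is non-abelian and `45 ≤ |G| ≤ 72`. *Proof.* If `G` is abelian then
`R(G) = |G|`. The maximal size of a TPP triple that `G` can realize is `|G|`. Therefore `G` cannot
be a C1 candidate. Assume then that `G` is non-abelian. The fact that `|G| ≥ 45` follows immediately
from [Neumann's inequality]. For the upper bounds, the fact that `T(G) ≤ (5/8)|G|` implies
`2|G| − T(G) ≥ (11/8)|G|` and hence, by Theorem 3.1, `R(G) ≥ (11/8)|G|`. So if `|G| > 72`, then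
`R(G) > 11 × 72 / 8 = 99`. Hence `G` is not a C1 candidate."  **Proposition 3.11.** "If `G` is a
C2 candidate, then `G` is non-abelian and `45 ≤ |G| ≤ 90`." ("If `|G| ≥ 91`, then
`R(G) ≥ 11 × 91 / 8 > 125`.")

## What is formalised (everything PROVED; `G : Type` a finite group; 3 definitions with bodies)

* `HartEtAl2013.lowerRankBound G` — the printed quantity `R̲(G)` (`T(G) = (irrChars G).ncard`,
  `b(G) = maxCharDegree G` of the topic `RepresentationTheory/FiniteGroups`);
  `HartEtAl2013.IsC1Candidate G`, `HartEtAl2013.IsC2Candidate G` — Def. 3.2 verbatim (with the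
  tree's `RealizesTPP G 5 5 5`); `lowerRankBound_of_comm` (`R̲(G) = |G|` for abelian `G`),
  `lowerRankBound_le_tensorRank` (`R̲(G) ≤ R(G)` when `b(G) ≤ 2`, from the sibling's Thm. 3.1 cases),
  `lowerRankBound_le_tensorRank'` (all cases; the third is the sibling's unconditional
  `HartEtAl2013_thm31_3'`, Bläser 2003 Thm. 14 being the tree theorem `blaser2003_thm14_holds`),
  `isC1Candidate_of_tensorRank_lt` / `isC2Candidate_of_tensorRank_lt` (`R(G) < 100` resp. `< 125`
  together with `⟨5,5,5⟩` ⇒ C1 resp. C2).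
* `HartEtAl2013.le_lowerRankBound_of_nonabelian` — the displayed step `R̲(G) ≥ (11/8)|G|` for
  non-abelian `G` (Lemma 3.3 = tree `HartEtAl2013_lemma33`), and the rank form
  `HartEtAl2013_tensorRank_ge_of_nonabelian : 11|G| ≤ 8 R(G)` (`R(G) = tensorRank (groupTensor ℂ G)`,
  from `HartEtAl2013_thm31_lower`).
* **`HartEtAl2013_prop38`**, **`HartEtAl2013_prop311`** — Props. 3.8 and 3.11 as printed, by the
  printed proof; `HartEtAl2013_prop38_rank`, `HartEtAl2013_prop311_rank` — the same windows under the
  hypothesis `R(G) < 100` (resp. `< 125`) on the rank itself, proved unconditionally from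
  `R(G) ≥ 2|G| − T(G)` (by `isC1Candidate_of_tensorRank_lt` these are Props. 3.8/3.11 restricted
  along Thm. 3.1, whose third case is conditional on Bläser's named fact).

* The row `[60,5]` of Table 3 and the sentence of §3.3 "one of the C2 candidates, `A₅`, is already
  known ([Neumann2011]) to have a `⟨5,5,5⟩` triple": `HartEtAl2013.maxCharDegree_alternatingGroup_five`
  (`b(A₅) = 5`, from the tree's degree content `1,3,3,4,5` of James–Liebeck Ex. 20.14),
  `HartEtAl2013.lowerRankBound_alternatingGroup_five` (`R̲(A₅) = 2·60 + 5 − 5 − 1 = 119`, the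
  printed Table-3 entry), **`HartEtAl2013_isC2Candidate_alternatingGroup_five`** (with the tree's
  `Neumann2011_alt5_realizes555`) and `HartEtAl2013_not_isC1Candidate_alternatingGroup_five`
  (Table 3 = "C2 candidates that are not C1 candidates"); `HartEtAl2013_rank_alternatingGroup_five_ge`
  (`R(ℂ[A₅]) ≥ 119`).

NOT formalised: the headline of §3 ("if a finite group `G` admits a `⟨5,5,5⟩` triple, then
`R(G) ≥ 100`"), which rests on the machine searches of Thms. 3.9, 3.10, 3.12 and §4 (the C1 list,
Table 2, is recorded in the census note `HHMM13-CANDIDATES.md`, not in Lean); the other 24 rows of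
Table 3 and the `R̄(G)` column.

## References

* [HartEtAl2013] S. Hart, I. Hedtke, M. Müller-Hannemann, S. Murthy, arXiv:1305.0448, Thm. 3.1,
  Def. 3.2, Lemma 3.3, Prop. 3.8, Prop. 3.11.
* [Pospelov2011] A. Pospelov, TAMC 2011, LNCS 6648, pp. 2–13, §3 Thm. 6, Remark 2 (the source of
  Thm. 3.1).
* [Neumann2011] P. M. Neumann, LMS J. Comput. Math. 14 (2011) 232–237 (`|G| ≥ 45`; the `⟨5,5,5⟩`
  triple of `Alt(5)`).
* [JamesLiebeck2001] G. James, M. Liebeck, *Representations and Characters of Groups*, Ex. 20.14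
  (the degrees `1, 3, 3, 4, 5` of `A₅`) — via the tree.
-/

noncomputable section

open scoped BigOperators
open Module

namespace Literature.Computability.AlgebraicComplexity

open Literature.RepresentationTheory.FiniteGroups

variable {G : Type} [Group G]

/-! ### Pospelov's lower bound `R̲(G)`, C1/C2 candidates (Def. 3.2), Propositions 3.8 and 3.11 -/

namespace HartEtAl2013

variable (G) in
/-- **`R̲(G)`, "the best known lower bound (Theorem 3.1) for `R(G)`"**: `|G|` if `b(G) = 1`,
`2|G| − T(G)` if `b(G) = 2`, and `2|G| + b(G) − T(G) − 1` if `b(G) ≥ 3`, with `T(G)` the number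
of irreducible complex characters and `b(G)` the largest irreducible degree (tree `maxCharDegree`).
[cite: HartEtAl2013, Thm. 3.1 (definition of the lower bound after it)] -/
def lowerRankBound : ℕ :=
  if maxCharDegree G = 1 then Nat.card G
  else if maxCharDegree G = 2 then 2 * Nat.card G - (irrChars G).ncard
  else 2 * Nat.card G + maxCharDegree G - (irrChars G).ncard - 1

/-- **C1 candidate** (Def. 3.2): "A group `G` that realizes `⟨5,5,5⟩` and satisfies `R̲(G) < 100`."
(A predicate on finite groups, not a named fact.) [cite: HartEtAl2013, Def. 3.2] -/
def IsC1Candidate (G : Type) [Group G] : Prop :=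
  RealizesTPP G 5 5 5 ∧ lowerRankBound G < 100

/-- **C2 candidate** (Def. 3.2): "A group `G` that realizes `⟨5,5,5⟩` and satisfies `R̲(G) < 125`."
(A predicate on finite groups, not a named fact.) [cite: HartEtAl2013, Def. 3.2] -/
def IsC2Candidate (G : Type) [Group G] : Prop :=
  RealizesTPP G 5 5 5 ∧ lowerRankBound G < 125

/-- Unfolding lemma for `lowerRankBound`. [cite: HartEtAl2013, Thm. 3.1] -/
theorem lowerRankBound_def : lowerRankBound G =
    if maxCharDegree G = 1 then Nat.card G
    else if maxCharDegree G = 2 then 2 * Nat.card G - (irrChars G).ncard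
    else 2 * Nat.card G + maxCharDegree G - (irrChars G).ncard - 1 := rfl

/-- A C1 candidate is a C2 candidate. [cite: HartEtAl2013, Def. 3.2] -/
theorem IsC1Candidate.isC2Candidate (h : IsC1Candidate G) : IsC2Candidate G :=
  ⟨h.1, h.2.trans (by norm_num)⟩

/-- For abelian `G`, `R̲(G) = |G|` ("If `G` is abelian then `R(G) = |G|`", proof of Prop. 3.8).
[cite: HartEtAl2013, Prop. 3.8 (proof)] -/
theorem lowerRankBound_of_comm [Finite G] (h : ∀ a b : G, a * b = b * a) :
    lowerRankBound G = Nat.card G := by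
  rw [lowerRankBound_def, if_pos (maxCharDegree_eq_one_iff.2 h)]

/-- **`R̲(G) ≤ R(G)` in the cases `b(G) ≤ 2`** (where Thm. 3.1 is an equality).
[cite: HartEtAl2013, Thm. 3.1] -/
theorem lowerRankBound_le_tensorRank [Fintype G] [DecidableEq G] (hb : maxCharDegree G ≤ 2) :
    lowerRankBound G ≤ tensorRank (groupTensor ℂ G) := by
  have h1 := one_le_maxCharDegree' G
  rw [lowerRankBound_def]
  rcases Nat.le_succ_iff.1 hb with hle | h2
  · have heq : maxCharDegree G = 1 := le_antisymm hle h1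
    rw [if_pos heq, HartEtAl2013_thm31_1 heq, Nat.card_eq_fintype_card (α := G)]
  · rw [if_neg (by omega), if_pos h2, ncard_irrChars_eq_card_conjClasses,
      Nat.card_eq_fintype_card (α := G)]
    have := HartEtAl2013_thm31_2 (G := G) h2
    omega

/-- **`R̲(G) ≤ R(G)` in all cases** (the case `b(G) ≥ 3` is Pospelov's Remark 2 with Bläser 2003,
Thm. 14 — the tree theorems `HartEtAl2013_thm31_3'` / `blaser2003_thm14_holds`).
[cite: HartEtAl2013, Thm. 3.1] -/
theorem lowerRankBound_le_tensorRank' [Fintype G] [DecidableEq G] :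
    lowerRankBound G ≤ tensorRank (groupTensor ℂ G) := by
  by_cases hb : maxCharDegree G ≤ 2
  · exact lowerRankBound_le_tensorRank hb
  · have h3 := HartEtAl2013_thm31_3' (G := G) (by omega)
    rw [lowerRankBound_def, if_neg (by omega), if_neg (by omega), ncard_irrChars_eq_card_conjClasses,
      Nat.card_eq_fintype_card (α := G)]
    omega

/-- Hence a group realizing `⟨5,5,5⟩` with `R(G) < 100` IS a C1 candidate (so the rank form
`HartEtAl2013_prop38_rank` below is Prop. 3.8 restricted along Thm. 3.1).
[cite: HartEtAl2013, Def. 3.2] -/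
theorem isC1Candidate_of_tensorRank_lt [Fintype G] [DecidableEq G]
    (h555 : RealizesTPP G 5 5 5) (hR : tensorRank (groupTensor ℂ G) < 100) : IsC1Candidate G :=
  ⟨h555, lowerRankBound_le_tensorRank'.trans_lt hR⟩

/-- Likewise for C2 candidates (`R(G) < 125`). [cite: HartEtAl2013, Def. 3.2] -/
theorem isC2Candidate_of_tensorRank_lt [Fintype G] [DecidableEq G]
    (h555 : RealizesTPP G 5 5 5) (hR : tensorRank (groupTensor ℂ G) < 125) : IsC2Candidate G :=
  ⟨h555, lowerRankBound_le_tensorRank'.trans_lt hR⟩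

/-- **The displayed step of the proof of Prop. 3.8**: for non-abelian `G`, "`T(G) ≤ (5/8)|G|`
implies `2|G| − T(G) ≥ (11/8)|G|`", so `R̲(G) ≥ (11/8)|G|` (in both remaining cases of Thm. 3.1);
Lemma 3.3 is the tree's `HartEtAl2013_lemma33`. Subtraction-free: `11|G| ≤ 8 R̲(G)`.
[cite: HartEtAl2013, Prop. 3.8 (proof)] -/
theorem le_lowerRankBound_of_nonabelian [Finite G] (h : ∃ a b : G, a * b ≠ b * a) :
    11 * Nat.card G ≤ 8 * lowerRankBound G := by
  cases nonempty_fintype G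
  have hb2 := two_le_maxCharDegree h
  have h33 := Literature.GroupTheory.CommutingProbability.HartEtAl2013_lemma33 h
  have hT : (irrChars G).ncard = Nat.card (ConjClasses G) := ncard_irrChars_eq_card_conjClasses
  rw [lowerRankBound_def, if_neg (by omega), hT]
  split_ifs with h2 <;> omega

end HartEtAl2013

open HartEtAl2013

/-- **Rank form of the step `R(G) ≥ (11/8)|G|` for non-abelian `G`** ("and hence, by Theorem 3.1,
`R(G) ≥ (11/8)|G|`", proof of Prop. 3.8): `11|G| ≤ 8 R(G)`, from `HartEtAl2013_thm31_lower` and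
Lemma 3.3. [cite: HartEtAl2013, Prop. 3.8 (proof)] -/
theorem HartEtAl2013_tensorRank_ge_of_nonabelian [Fintype G] [DecidableEq G]
    (h : ∃ a b : G, a * b ≠ b * a) : 11 * Fintype.card G ≤ 8 * tensorRank (groupTensor ℂ G) := by
  have h1 := HartEtAl2013_thm31_lower (G := G)
  have h33 := Literature.GroupTheory.CommutingProbability.HartEtAl2013_lemma33 h
  rw [Nat.card_eq_fintype_card (α := G)] at h33
  omega

/-- **HHMM Prop. 3.8**: "If `G` is a C1 candidate, then `G` is non-abelian and `45 ≤ |G| ≤ 72`."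
Proof as printed: abelian `G` has `R̲(G) = |G|` and realizes `⟨5,5,5⟩` only if `|G| ≥ 125` (tree
`no555_of_isMulCommutative`); `|G| ≥ 45` is Neumann's bound (tree `Neumann2011_card_ge_45`);
`R̲(G) ≥ (11/8)|G|` and `R̲(G) ≤ 99` give `|G| ≤ 72`. [cite: HartEtAl2013, Prop. 3.8] -/
theorem HartEtAl2013_prop38 [Finite G] (h : IsC1Candidate G) :
    (∃ a b : G, a * b ≠ b * a) ∧ 45 ≤ Nat.card G ∧ Nat.card G ≤ 72 := by
  obtain ⟨h555, hR⟩ := h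
  have hnab : ∃ a b : G, a * b ≠ b * a := by
    by_contra hab
    push Not at hab
    have h125 : 125 ≤ Nat.card G := by
      by_contra hlt
      push Not at hlt
      haveI : IsMulCommutative G := ⟨⟨hab⟩⟩
      exact no555_of_isMulCommutative hlt h555
    rw [lowerRankBound_of_comm hab] at hR
    omega
  have h11 := le_lowerRankBound_of_nonabelian hnab
  exact ⟨hnab, Neumann2011_card_ge_45 h555, by omega⟩

/-- **HHMM Prop. 3.11**: "If `G` is a C2 candidate, then `G` is non-abelian and `45 ≤ |G| ≤ 90`."
("We use the same arguments as in the proof of Proposition 3.8: If `|G| ≥ 91`, then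
`R(G) ≥ 11 × 91/8 > 125`.") [cite: HartEtAl2013, Prop. 3.11] -/
theorem HartEtAl2013_prop311 [Finite G] (h : IsC2Candidate G) :
    (∃ a b : G, a * b ≠ b * a) ∧ 45 ≤ Nat.card G ∧ Nat.card G ≤ 90 := by
  obtain ⟨h555, hR⟩ := h
  have hnab : ∃ a b : G, a * b ≠ b * a := by
    by_contra hab
    push Not at hab
    have h125 : 125 ≤ Nat.card G := by
      by_contra hlt
      push Not at hlt
      haveI : IsMulCommutative G := ⟨⟨hab⟩⟩
      exact no555_of_isMulCommutative hlt h555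
    rw [lowerRankBound_of_comm hab] at hR
    omega
  have h11 := le_lowerRankBound_of_nonabelian hnab
  exact ⟨hnab, Neumann2011_card_ge_45 h555, by omega⟩

/-- **Prop. 3.8 in rank form**: if `G` realizes `⟨5,5,5⟩` and `R(G) < 100` (so that the realization
would beat Makarov's `R(5) ≤ 100`, cf. `RealizesTPP.tensorRank_matMulTensor_le`), then `G` is
non-abelian and `45 ≤ |G| ≤ 72` (abelian: `R(G) ≥ 2|G| − k(G) = |G| ≥ 125`; non-abelian:
`8R(G) ≥ 11|G|`). [cite: HartEtAl2013, Prop. 3.8] -/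
theorem HartEtAl2013_prop38_rank [Fintype G] [DecidableEq G] (h555 : RealizesTPP G 5 5 5)
    (hR : tensorRank (groupTensor ℂ G) < 100) :
    (∃ a b : G, a * b ≠ b * a) ∧ 45 ≤ Fintype.card G ∧ Fintype.card G ≤ 72 := by
  have hlow := HartEtAl2013_thm31_lower (G := G)
  have hnab : ∃ a b : G, a * b ≠ b * a := by
    by_contra hab
    push Not at hab
    have h125 : 125 ≤ Fintype.card G := by
      by_contra hlt
      push Not at hlt
      haveI : IsMulCommutative G := ⟨⟨hab⟩⟩
      exact no555_of_isMulCommutative (by rwa [Nat.card_eq_fintype_card (α := G)]) h555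
    -- abelian: every conjugacy class is a singleton, `k(G) ≤ |G|` suffices
    have hcl : Nat.card (ConjClasses G) ≤ Fintype.card G := by
      rw [← Nat.card_eq_fintype_card]
      exact Nat.card_le_card_of_surjective _ (ConjClasses.mk_surjective (α := G))
    omega
  have h11 := HartEtAl2013_tensorRank_ge_of_nonabelian hnab
  have h45 := Neumann2011_card_ge_45 h555
  rw [Nat.card_eq_fintype_card (α := G)] at h45
  exact ⟨hnab, h45, by omega⟩

/-- **Prop. 3.11 in rank form**: if `G` realizes `⟨5,5,5⟩` and `R(G) < 125`, then `G` is non-abelian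
and `45 ≤ |G| ≤ 90`. [cite: HartEtAl2013, Prop. 3.11] -/
theorem HartEtAl2013_prop311_rank [Fintype G] [DecidableEq G] (h555 : RealizesTPP G 5 5 5)
    (hR : tensorRank (groupTensor ℂ G) < 125) :
    (∃ a b : G, a * b ≠ b * a) ∧ 45 ≤ Fintype.card G ∧ Fintype.card G ≤ 90 := by
  have hlow := HartEtAl2013_thm31_lower (G := G)
  have hnab : ∃ a b : G, a * b ≠ b * a := by
    by_contra hab
    push Not at hab
    have h125 : 125 ≤ Fintype.card G := by
      by_contra hlt
      push Not at hlt
      haveI : IsMulCommutative G := ⟨⟨hab⟩⟩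
      exact no555_of_isMulCommutative (by rwa [Nat.card_eq_fintype_card (α := G)]) h555
    have hcl : Nat.card (ConjClasses G) ≤ Fintype.card G := by
      rw [← Nat.card_eq_fintype_card]
      exact Nat.card_le_card_of_surjective _ (ConjClasses.mk_surjective (α := G))
    omega
  have h11 := HartEtAl2013_tensorRank_ge_of_nonabelian hnab
  have h45 := Neumann2011_card_ge_45 h555
  rw [Nat.card_eq_fintype_card (α := G)] at h45
  exact ⟨hnab, h45, by omega⟩

/-! ### Table 3, row `[60,5]`: `A₅` is a C2 candidate with `R̲(A₅) = 119` -/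

section AlternatingFive

open Literature.RepresentationTheory.FiniteGroups.AlternatingFive
open Literature.NumberTheory.GaloisRepresentations.Serre1972 (natCard_alternatingGroup_fin_five)

/-- There is no irreducible character of `A₅` of degree `6` or `7`, and there is one of degree `5`
(James–Liebeck Ex. 20.14: degrees `1, 3, 3, 4, 5`; tree `JamesLiebeck2001_ex2014_degrees` as counts).
[cite: JamesLiebeck2001, Example 20.14] -/
private theorem alternatingFive_degree_aux :
    IsEmpty {χ : alternatingGroup (Fin 5) → ℂ // IsIrrChar _ χ ∧ χ 1 = ((6 : ℕ) : ℂ)} ∧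
    IsEmpty {χ : alternatingGroup (Fin 5) → ℂ // IsIrrChar _ χ ∧ χ 1 = ((7 : ℕ) : ℂ)} ∧
    Nonempty {χ : alternatingGroup (Fin 5) → ℂ // IsIrrChar _ χ ∧ χ 1 = ((5 : ℕ) : ℂ)} := by
  obtain ⟨-, -, -, -, h5, h6, h7⟩ := JamesLiebeck2001_ex2014_degrees
  have hfin : ∀ d : ℕ, Finite {χ : alternatingGroup (Fin 5) → ℂ // IsIrrChar _ χ ∧ χ 1 = (d : ℂ)} :=
    fun d => ((irrChars_finite_holds (alternatingGroup (Fin 5))).subset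
      (fun χ (h : IsIrrChar _ χ ∧ χ 1 = (d : ℂ)) => h.1)).to_subtype
  refine ⟨?_, ?_, ?_⟩
  · rcases Nat.card_eq_zero.1 h6 with h | h
    · exact h
    · exact absurd h (not_infinite_iff_finite.2 (hfin 6))
  · rcases Nat.card_eq_zero.1 h7 with h | h
    · exact h
    · exact absurd h (not_infinite_iff_finite.2 (hfin 7))
  · haveI := hfin 5
    exact Nat.card_pos_iff.1 (by omega) |>.1

/-- **`b(A₅) = 5`**: the largest irreducible degree of `A₅` (degrees `1, 3, 3, 4, 5`, James–Liebeck
Ex. 20.14; HHMM Table 3 lists the pattern `(1¹,3²,4¹,5¹)` for `[60,5] = A₅`).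
[cite: HartEtAl2013, Table 3 (row [60,5])] [cite: JamesLiebeck2001, Example 20.14] -/
theorem HartEtAl2013.maxCharDegree_alternatingGroup_five : maxCharDegree (alternatingGroup (Fin 5)) = 5 := by
  obtain ⟨h6, h7, ⟨⟨χ, hχ, hχ5⟩⟩⟩ := alternatingFive_degree_aux
  have h5mem : 5 ∈ charDegrees (alternatingGroup (Fin 5)) := by
    obtain ⟨d, hd, hχd⟩ := hχ.exists_apply_one
    rw [hχ5] at hχd
    have : d = 5 := by exact_mod_cast hχd.symm
    rwa [this] at hd
  refine le_antisymm (csSup_le (charDegrees_nonempty (G := alternatingGroup (Fin 5))) fun d hd => ?_)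
    (le_maxCharDegree (bddAbove_charDegrees' _) h5mem)
  have hl := AlternatingFive.charDegrees_subset hd
  obtain ⟨ψ, hψ, hψd⟩ := exists_isIrrChar_of_mem_charDegrees hd
  simp only [List.mem_cons, List.not_mem_nil, or_false] at hl
  rcases hl with rfl | rfl | rfl | rfl | rfl | rfl | rfl <;> try omega
  · exact (h6.false ⟨ψ, hψ, hψd⟩).elim
  · exact (h7.false ⟨ψ, hψ, hψd⟩).elim

/-- **Table 3, row `[60,5]`: `R̲(A₅) = 119`** (`= 2·60 + b − T − 1` with `b(A₅) = 5`, `T(A₅) = 5`).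
[cite: HartEtAl2013, Table 3 (row [60,5])] -/
theorem HartEtAl2013.lowerRankBound_alternatingGroup_five :
    HartEtAl2013.lowerRankBound (alternatingGroup (Fin 5)) = 119 := by
  rw [HartEtAl2013.lowerRankBound_def, HartEtAl2013.maxCharDegree_alternatingGroup_five,
    ncard_irrChars_eq_card_conjClasses, card_conjClasses, natCard_alternatingGroup_fin_five]
  norm_num

/-- **`A₅` is a C2 candidate** (§3.3: "one of the C2 candidates, `A₅`, is already known
([Neumann2011]) to have a `⟨5,5,5⟩` triple"; Table 3 row `[60,5]`): `A₅` realizes `⟨5,5,5⟩` (tree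
`Neumann2011_alt5_realizes555`) and `R̲(A₅) = 119 < 125`. [cite: HartEtAl2013, §3.3 and Table 3] -/
theorem HartEtAl2013_isC2Candidate_alternatingGroup_five :
    HartEtAl2013.IsC2Candidate (alternatingGroup (Fin 5)) :=
  ⟨Neumann2011_alt5_realizes555.1, by rw [HartEtAl2013.lowerRankBound_alternatingGroup_five]; norm_num⟩

/-- … **but not a C1 candidate** (`R̲(A₅) = 119 ≥ 100`; Table 3 = "All possible C2 candidates that
are not C1 candidates"). [cite: HartEtAl2013, Table 3 (row [60,5])] -/
theorem HartEtAl2013_not_isC1Candidate_alternatingGroup_five :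
    ¬ HartEtAl2013.IsC1Candidate (alternatingGroup (Fin 5)) := fun h => by
  have := h.2
  rw [HartEtAl2013.lowerRankBound_alternatingGroup_five] at this
  omega

/-- Hence **`R(ℂ[A₅]) ≥ 119`** (Thm. 3.1, case `b ≥ 3`, unconditional in the tree).
[cite: HartEtAl2013, Thm. 3.1] [cite: HartEtAl2013, Table 3 (row [60,5])] -/
theorem HartEtAl2013_rank_alternatingGroup_five_ge :
    119 ≤ tensorRank (groupTensor ℂ (alternatingGroup (Fin 5))) := by
  rw [← HartEtAl2013.lowerRankBound_alternatingGroup_five]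
  exact HartEtAl2013.lowerRankBound_le_tensorRank'

end AlternatingFive

end Literature.Computability.AlgebraicComplexity

end
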